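import Summits.Ventures.Crystal3D.Theorems.StickyWulffConstantCoaxialWallLawDebtFaultRow
import Summits.Ventures.Crystal3D.Theorems.StickyWulffConstantCoaxialWallLawPayerTransPlaneRowGen
import HarnessLib

/-!
# Debt: `CoaxialTwoSlabAdhesionCoherentFault` FROM THE TRANSLATION CENSUS ROW at every version (v1/v2)

HONEST FRAMING. Venture `Summits/Ventures/Crystal3D` (cell `crystal3d-full`), helper `--supports` the crux
`CoaxialWallLaw` of `route-Ventures-StickyWulffConstant` (REGISTERED line `WallLedgerF`).  Rung credit; F-C1 not
moved; CONDITIONAL on named facts.  cf-p1 g28 (xxxviii″): `coaxialTwoSlabAdhesionCoherentFault_of_row` (`…DebtFaultRow`)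
VERBATIM with the census Prop at version `ver` (`EndRowTrans ver s_F`) and the rung `coaxialTwoSlabAdhesion_trans_skew_row_gen
ver`; the class-(C) arithmetic `cube_of_coherentFault` is imported unchanged.

* **`coaxialTwoSlabAdhesionCoherentFault_of_row_gen`**.  WHAT THIS IS NOT: not the row; F-C1 not moved.
-/

noncomputable section

namespace Summit.Ventures.Crystal3D.Theorems

open Summit.Ventures.Crystal3D Finset NearIdentity
open Literature.MathematicalPhysics.StatisticalMechanics (fccStacking barlowStacking IsHaggSeq constHagg
  isHaggSeq_const contactDeficiency)
open scoped InnerProductSpace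

section Row

variable (ver : WordVersion) {δ : ℝ} (hg : KissingGap δ) (hc : KissingClassification δ)
variable {sF : ℝ} (hsF : 0 < sF) (hsF' : sF ≤ 2 * Real.sqrt 6)
include hg hc hsF hsF'

open scoped Classical in
/-- **Debt 2 from the in-plane translation row.**  See the module docstring. -/
theorem coaxialTwoSlabAdhesionCoherentFault_of_row_gen (hrowT : EndRowTrans ver sF) :
    CoaxialTwoSlabAdhesionCoherentFault := by
  intro A₁ t₁ A₂ t₂ hcoax hne hS
  obtain ⟨-, hΛ₂, n, hn1, hmenu, a, ha⟩ := hS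
  have htrans : A₁ '' fccStacking 1 (Real.sqrt (2 / 3)) = A₂ '' fccStacking 1 (Real.sqrt (2 / 3)) := hΛ₂.symm
  set e₃ : EuclideanSpace ℝ (Fin 3) := EuclideanSpace.single (2 : Fin 3) (1 : ℝ) with he₃
  set τ : EuclideanSpace ℝ (Fin 3) := A₁.symm (t₂ - t₁) with hτ
  have hτΛ : τ ∉ fccStacking 1 (Real.sqrt (2 / 3)) := offset_notMem_of_ne A₁ A₂ t₁ t₂ htrans hne
  -- the model normal `μ = A₁⁻¹ n`
  set μ : EuclideanSpace ℝ (Fin 3) := A₁.symm n with hμ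
  have hAμ : A₁ μ = n := A₁.apply_symm_apply n
  have hμ1 : ‖μ‖ = 1 := by rw [hμ, LinearIsometryEquiv.norm_map, hn1]
  have hμmenu : ∀ w ∈ fccSlots, ⟪w, μ⟫_ℝ = 0 ∨ ⟪w, μ⟫_ℝ = Real.sqrt (2 / 3) ∨ ⟪w, μ⟫_ℝ = -Real.sqrt (2 / 3) := by
    intro w hw
    have := hmenu w hw
    rwa [← hAμ, LinearIsometryEquiv.inner_map_map] at this
  have ha' : τ - (a : ℝ) • (Real.sqrt (2 / 3) • μ) ∈ fccStacking 1 (Real.sqrt (2 / 3)) := by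
    have e : A₁.symm (t₂ - t₁ - (a : ℝ) • (Real.sqrt (2 / 3) • n)) = τ - (a : ℝ) • (Real.sqrt (2 / 3) • μ) := by
      rw [map_sub, LinearIsometryEquiv.map_smul, LinearIsometryEquiv.map_smul]
    rw [← e]; exact ha
  obtain ⟨c, hcube⟩ := cube_of_coherentFault hμ1 hμmenu ha' hτΛ
  obtain ⟨L', hL', hskew⟩ := exists_skewFrame_of_cube A₁ τ c hcube
  obtain ⟨C, R₀, hR₀, hmain⟩ := coaxialTwoSlabAdhesion_trans_skew_row_gen ver hg hc A₁ t₁ A₂ t₂ L' hL' htrans hskew hsF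
    (hrowT L')
  refine ⟨L', t₁, t₂, constHagg, constHagg, isHaggSeq_const, isHaggSeq_const,
    movedFcc_subset_frame_of_image_eq A₁ L' t₁ hL'.symm,
    movedFcc_subset_frame_of_image_eq A₂ L' t₂ (hΛ₂.trans hL'.symm), C, R₀, hR₀, ?_⟩
  intro h hh ρ hρ X P₁ P₂ hX hP₁X hP₂X₁ hcyl hP₁ hP₂
  have key := hmain h hh ρ hρ X P₁ P₂ hX hP₁X hP₂X₁ hcyl hP₁ hP₂
  have hhalf : (1 / 2 : ℝ) * Real.sqrt (1 - ⟪L' e₃, e₃⟫_ℝ ^ 2) ≤ Real.sqrt 6 / sF * Real.sqrt (1 - ⟪L' e₃, e₃⟫_ℝ ^ 2) := by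
    refine mul_le_mul_of_nonneg_right ?_ (Real.sqrt_nonneg _)
    rw [le_div_iff₀ hsF]
    linarith only [hsF']
  have hπρ : 0 ≤ Real.pi * ρ ^ 2 := by positivity
  have := mul_le_mul_of_nonneg_right hhalf hπρ
  linarith only [key, this]

end Row

end Summit.Ventures.Crystal3D.Theorems

end
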